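import Summits.ValiantsHypothesis.ValiantsHypothesis.Theorems.BarrierLeverAnchoredDoorHitsLowerPairsConjZprime
import Summits.ValiantsHypothesis.ValiantsHypothesis.Theorems.BarrierLeverAnchoredDoorHitsLowerPairsVertexStep

/-!
# Support item `AnchoredDoorHitsLowerPairs` (stmt-ValiantsHypothesis-22510), line `anchored-peeling`:
# CONJECTURE Z′ AT PROFILE 1 — the profile-parametric form of the registered working conjecture, and why its profile-1 instance is the
# one whose numerics reach beyond distinct anchors

Helper file (`--supports stmt-ValiantsHypothesis-22510`; cell valiant-natproofs, rung V4; prover seat val-np-p1 gen 27; memo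
HOME/val-np-p1/g27/MEMO-DA-profile2-valnp1-g27.md §7). Closes NO item; OFFERS a node (planner's call).

WHY. The registered working conjecture Z′ (`Stmt.stub_conjZprime`, p705798) is the tail-graded dominant problem at PROFILE 2. K1′
(`PT.symbolicDet_ne_zero_of_ptEntry`, p705454) is profile-parametric, so the same conjecture can be stated at every profile `s`; its profile-1
instance Z′(1) is STRONGER as a statement (it gives `symbolicDet 1 ≠ 0` for every lower pair, i.e. U1, hence every profile by `…Mono`) — and
it is the instance whose numerical tests are INFORMATIVE: at profile 2 every explicit pair of the line's censuses is a distinct-anchor pair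
(memo §1; `…DACheck`, `…DAResidual`), so profile-2 certificates never leave the Hall regime of 𝔄₂, whereas at profile 1 the distinct-anchor bound is
`r − 1 ≤ f₁(R) · f₁(C)` and every cube-minus-top / truncated-ball pair, the Golay pair, D_k, cube/ball lies beyond it. EVIDENCE at profile 1
(lab/zprime1.py; kit j328571, exact mod 2⁶¹ − 1, PRF parameters; 0 failures): 394 lower pairs BEYOND distinct anchors at profile 1 — the 16 named
pairs of the censuses with 48 ≤ r ≤ 511, cube_{2k}/B(2k+1,k) (k = 3, 4), 130 pairs cube_n against random 2-complexes K_N + T (5 ≤ n ≤ 9), 6 against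
random graphs, 240 random lower pairs (r ≤ 160, 24 of them failing profile-1 nested Hall in BOTH orientations): the tight tail-graded PROFILE-1
dominant determinant with Hungarian potentials is NONZERO in both orientations for all 325 pairs with r ≤ 160 (Z′(1)), and in a nested-Hall
orientation already the tail-free profile-1 door (`ψ = 0`, potentials `0`) is nonsingular for all 370 pairs that have one (up to r = 512).

CONTENTS. `Stmt.stub_conjZprimeAt s` (Z′ at profile `s`; `Stmt.stub_conjZprimeAt 2` is `Stmt.stub_conjZprime` VERBATIM, `stub_conjZprimeAt_two_iff`),
`Stmt.stub_conjZprime1 := Stmt.stub_conjZprimeAt 1`; arrows: `symbolicDet_ne_zero_of_conjZprimeAt` (profile `s`, every lower pair),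
`symbolicDet_ne_zero_of_conjZprime1` (every profile `s ≥ 1`), **`stub_vertexStep_of_conjZprime1`** (Z′(1) ⟹ the REGISTERED stub `Stmt.stub_vertexStep`
of `…VertexStep`, p585609 — outright, its hypotheses unused), `stub_ltRestNonCanonRSW_of_conjZprime1` / `…_of_conjZprimeAt`, and BY NAME
`anchoredDoorHitsLowerPairs_of_conjZprime1` / `…_of_conjZprimeAt`. (Z′(1) does NOT formally give Z′(2) — different dominant matrices — so no arrow between them.)

WHAT THIS IS NOT: Z′(1) is not proved; nothing on crux stmt-ValiantsHypothesis-14610 or on `VP` versus `VNP`.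
-/

set_option linter.dupNamespace false

namespace Summit.ValiantsHypothesis.ValiantsHypothesis.Theorems.BarrierLever.AnchoredPeeling

/-- **CONJECTURE Z′ AT PROFILE `s` (the tail-graded dominant problem; orientation-free).** For every `h`, `r` and every pair of injective
enumerations `u`, `w` of lower families in `Fin h`, there are row potentials `a`, column discounts `c`, admissible at profile `s`
(`a i ≤ c j` or `a i + s|u i| ≤ |w j| + c j`), and complex `Θ Φ Ψ` with the tail-graded dominant matrix
`([c j ≤ a i] · PT.ptEntry s (a i − c j) Θ Φ Ψ (w j) (u i))_{i j}` nonsingular. At `s = 2` this is `Stmt.stub_conjZprime` verbatim. -/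
def Stmt.stub_conjZprimeAt (s : ℕ) : Prop :=
  ∀ (h r : ℕ) (u w : Fin r → Finset (Fin h)), Function.Injective u → Function.Injective w →
    IsLowerSet (Set.range u) → IsLowerSet (Set.range w) →
    ∃ (a c : Fin r → ℕ), (∀ i j, a i ≤ c j ∨ a i + s * (u i).card ≤ (w j).card + c j) ∧
      ∃ (Θ : Finset (Fin h) × Finset (Fin h) → ℂ) (Φ Ψ : Finset (Fin h) × Finset (Fin h) → Fin h → ℂ),
        (Matrix.of fun i j : Fin r => if c j ≤ a i then PT.ptEntry s (a i - c j) Θ Φ Ψ (w j) (u i) else 0).det ≠ 0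

/-- **CONJECTURE Z′(1)** — the profile-1 instance (implies U1; the numerically informative one). -/
def Stmt.stub_conjZprime1 : Prop := Stmt.stub_conjZprimeAt 1

/-- The profile-2 instance IS the registered working conjecture `Stmt.stub_conjZprime` (texts agree definitionally). -/
theorem stub_conjZprimeAt_two_iff : Stmt.stub_conjZprimeAt 2 ↔ Stmt.stub_conjZprime := Iff.rfl

/-- **Z′ at profile `s` ⟹ every injective lower pair is hit at profile `s`** (K1′, `PT.symbolicDet_ne_zero_of_ptEntry`). -/
theorem symbolicDet_ne_zero_of_conjZprimeAt {s : ℕ} (hZ : Stmt.stub_conjZprimeAt s) {h r : ℕ} (u w : Fin r → Finset (Fin h))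
    (hu : Function.Injective u) (hw : Function.Injective w) (hlu : IsLowerSet (Set.range u)) (hlw : IsLowerSet (Set.range w)) :
    symbolicDet s h r u w ≠ 0 := by
  obtain ⟨a, c, hac, Θ, Φ, Ψ, hdet⟩ := hZ h r u w hu hw hlu hlw
  exact PT.symbolicDet_ne_zero_of_ptEntry Θ Φ Ψ u w a c hac hdet

/-- **Z′(1) ⟹ hits at EVERY profile `s ≥ 1`** (`symbolicDet_ne_zero_mono`). -/
theorem symbolicDet_ne_zero_of_conjZprime1 (hZ : Stmt.stub_conjZprime1) {s h r : ℕ} (hs : 1 ≤ s) (u w : Fin r → Finset (Fin h))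
    (hu : Function.Injective u) (hw : Function.Injective w) (hlu : IsLowerSet (Set.range u)) (hlw : IsLowerSet (Set.range w)) :
    symbolicDet s h r u w ≠ 0 :=
  symbolicDet_ne_zero_mono hs (symbolicDet_ne_zero_of_conjZprimeAt hZ u w hu hw hlu hlw)

/-- **Z′(1) ⟹ THE REGISTERED STUB `stub_vertexStep`** (p585609; outright — the step's hypotheses are not needed). -/
theorem stub_vertexStep_of_conjZprime1 (hZ : Stmt.stub_conjZprime1) : Stmt.stub_vertexStep := by
  intro h r u w hu hw hlu hlw _ _ _
  exact symbolicDet_ne_zero_of_conjZprimeAt hZ u w hu hw hlu hlw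

/-- **Z′(1) ⟹ the v26 residual `Stmt.stub_ltRestNonCanonRSW` OUTRIGHT** (at `s = 1`, `h₀ = 0`). -/
theorem stub_ltRestNonCanonRSW_of_conjZprime1 (hZ : Stmt.stub_conjZprime1) : Stmt.stub_ltRestNonCanonRSW := by
  refine ⟨1, 0, le_refl 1, ?_⟩
  intro h _ r u w hu hw hlu hlw _ _ _ _ _ _ _ _ _ _ _ _ _
  exact symbolicDet_ne_zero_of_conjZprimeAt hZ u w hu hw hlu hlw

/-- **Z′ at any profile `s ≥ 1` ⟹ the v26 residual `Stmt.stub_ltRestNonCanonRSW`.** -/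
theorem stub_ltRestNonCanonRSW_of_conjZprimeAt {s : ℕ} (hs : 1 ≤ s) (hZ : Stmt.stub_conjZprimeAt s) : Stmt.stub_ltRestNonCanonRSW := by
  refine ⟨s, 0, hs, ?_⟩
  intro h _ r u w hu hw hlu hlw _ _ _ _ _ _ _ _ _ _ _ _ _
  exact symbolicDet_ne_zero_of_conjZprimeAt hZ u w hu hw hlu hlw

/-- **Composition BY NAME: `Stmt.stub_conjZprime1 → AnchoredDoorHitsLowerPairs`** (through the registered stub `stub_vertexStep` one could equally go;
here via the v26 residual, p695484's composition). -/
theorem anchoredDoorHitsLowerPairs_of_conjZprime1 (hZ : Stmt.stub_conjZprime1) :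
    Summit.ValiantsHypothesis.ValiantsHypothesis.Theses.BarrierLever.AnchoredDoorHitsLowerPairs :=
  anchoredDoorHitsLowerPairs_of_ltRestNonCanonRSW (stub_ltRestNonCanonRSW_of_conjZprime1 hZ)

/-- **Composition BY NAME at any profile: `Stmt.stub_conjZprimeAt s → AnchoredDoorHitsLowerPairs`** for `s ≥ 1`. -/
theorem anchoredDoorHitsLowerPairs_of_conjZprimeAt {s : ℕ} (hs : 1 ≤ s) (hZ : Stmt.stub_conjZprimeAt s) :
    Summit.ValiantsHypothesis.ValiantsHypothesis.Theses.BarrierLever.AnchoredDoorHitsLowerPairs :=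
  anchoredDoorHitsLowerPairs_of_ltRestNonCanonRSW (stub_ltRestNonCanonRSW_of_conjZprimeAt hs hZ)

end Summit.ValiantsHypothesis.ValiantsHypothesis.Theorems.BarrierLever.AnchoredPeeling
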